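import Literature.AnabelianGeometry.SemiGraphs.ArithBranchActionConsequences
import HarnessLib

/-!
# [SemiAnbd] §5 p. 65 / Thm 5.4: the edge-like subgroups of the PRODUCED decomposition data do not
# depend on the chosen §3 representatives (under commensurator growth along `ι`)

Mochizuki, *Semi-graphs of anabelioids*, Publ. RIMS **42** (2006) 221–322, §5 p. 65 ("`Π^temp_{𝔊,b} ⊆
Π^temp_{𝔊,v}` … may be thought of as the commensurator in `Π^temp_{𝔊,v}` of `Π^temp_{𝔾,b}`", the
decomposition groups being "well-defined up to conjugation in `Π^temp_𝔊`"), Def 5.3 (iii) p. 65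
("edge-like" subgroups: those "of the form `Π^temp_{𝔊,b}`"), Thm 3.7 (iii) p. 41 (the edge-like subgroups of
`π₁^temp(𝒢)` attached to an edge form one conjugacy class), Thm 5.4 p. 66 ("the arithmetic actions on the
underlying graphs … do not switch the branches of any edge"). [cite: MochizukiSemiAnbd2006, §5, p. 65]

PROOF-ONLY companion (abc-iut cell, layer L3, sub-DAG `plan/L3/SUBDAG-SemiAnbd-Thm54.md`; row
«T54·Rc-INVARIANCE», EDGE half, seat abc-iut-w4-d089 gen 7; the row was named by abc-iut-w4-d059: "the
producers assume `Rc` MATCHED (`hRcV`/`hRcB`); for an arbitrary `ChartRepresentatives` the branch dictionary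
can fail at loop edges (`Rc.Hb b` may be the other branch's edge-like subgroup) — Rc-invariance of
`ArithMaximalCompactStatementI/II` is believed true but NOT typed").  No definition, no new named fact.

The typed predicates `ArithMaximalCompactStatementI/II D aug` of `ArithMaximalCompact.lean` see the
decomposition data `D` ONLY through the two notions `IsVerticial D` / `IsEdgeLike D` (Def 5.3 (iii)).  For the
produced data `D := decompositionDataOfChart R ι` (abc-iut-w4-d053, `ArithDecompositionData.lean`) the VERTEX
notion is already independent of the choice `R : ChartRepresentatives c`
(`isVerticial_decompositionDataOfChart_iff`: one conjugacy class of verticial subgroups per vertex, and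
commensurators are conjugation-equivariant).  This file does the same for the EDGE notion, under the one
LEVEL-A menu input of the Thm 5.4 assembly where the print hypothesis "no switching of branches" enters the
data — commensurator growth along `ι`,

  (H-CE) `∀ e v L H, L ∈ edgeLikeSubgroups c e → H ∈ verticialSubgroups c v → L ≤ H → C(ι L) ≤ C(ι H)`

(a hypothesis that does not mention `R`; DISCHARGED in the tree over abc-iut-w4-d053's package
`ArithChartBranchAction` by abc-iut-w4-d040's `ArithChartBranchAction.commensurator_map_le_of_edgeLike_le_verticialAt`
from `CompactInVerticialAt 𝒢`, `Thm37Hypotheses`, `IsGraph`, `ι` injective and `NoBranchSwitching`):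

* `arithBrGp_eq_commensurator_map_of_hCE` — under (H-CE) the produced branch group is the FULL commensurator
  of the image of the chosen edge-like subgroup, `Π^temp_{𝔊,b} = C(ι Π^temp_{𝔾,b})`, for EVERY branch `b`
  (abutting to `v`: `C(ι Π^temp_{𝔾,b}) ≤ C(ι Π^temp_{𝔾,v}) = Π^temp_{𝔊,v}` by (H-CE) and `R.Hb_le`; abutting to
  no vertex: `⊤ ⊓ C`).  In particular the vertex group — and with it WHICH branch of a loop edge the chosen
  representative "really" belongs to — has dropped out;
* `isEdgeLike_decompositionDataOfChart_iff_of_hCE` — hence "`K` is edge-like for the produced data" reads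
  `∃ b L g, L ∈ edgeLikeSubgroups c (edgeOf b) ∧ K = g · C(ι L) · g⁻¹`, an `R`-FREE description (one
  conjugacy class of edge-like subgroups per edge, `exists_conj_of_mem_edgeLikeSubgroups`, and
  `commensurator_conjSubgroup` — verbatim the pattern of `isVerticial_decompositionDataOfChart_iff`);
* `isEdgeLike_decompositionDataOfChart_iff_isEdgeLike_of_hCE` — so the edge-like notion is the SAME for any
  two choices `R`, `R'` of representatives;
* the `…At` forms with (H-CE) bound by name to `ArithChartBranchAction.commensurator_map_le_of_edgeLike_le_verticialAt`
  (`ArithChartBranchAction.arithBrGp_eq_commensurator_mapAt`, `….isEdgeLike_decompositionDataOfChart_iffAt`,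
  `….isEdgeLike_decompositionDataOfChart_iff_isEdgeLikeAt`): residual inputs = the package, Thm 3.7 (iii) at
  `𝒢` (`CompactInVerticialAt 𝒢`; for finite `𝔾` a theorem, `compactInVerticialAt_of_finiteGraph`), the print
  hypotheses `Thm37Hypotheses` / `IsGraph`, `ι` injective (Prop 5.2 (iv)), and Thm 5.4's "no switching".

The statement-level transfer (`ArithMaximalCompactStatementI/II` at an arbitrary `Rc`, dropping the
integrators' binders `hRcV`/`hRcB`) is abc-iut-w4-d059's half of the row and is NOT done here.  Nothing here
takes a side on [IUTchIII] Cor. 3.12; typed ≠ proved for the package and for Thm 5.4 itself.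
-/

namespace Literature.AnabelianGeometry.SemiGraphs

namespace ProfiniteSemiGraph

open CategoryTheory Topology
open scoped Pointwise

universe u u' u''

variable {𝒢 : ProfiniteSemiGraph.{u}} {c : TemperedPiChart 𝒢} {Gtp : Type u'} [Group Gtp]

/-! ### The produced branch group under commensurator growth (H-CE) -/

/-- **`Π^temp_{𝔊,b} = C(ι Π^temp_{𝔾,b})` under (H-CE)**: the produced branch group of p. 65 ("the commensurator
in `Π^temp_{𝔊,v}` of `Π^temp_{𝔾,b}`", typed as `Π^temp_{𝔊,v} ⊓ C(ι Π^temp_{𝔾,b})`) is the full commensurator of the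
image of the chosen edge-like subgroup, for EVERY branch `b`: if `b` abuts to `v` then
`C(ι Π^temp_{𝔾,b}) ≤ C(ι Π^temp_{𝔾,v}) = Π^temp_{𝔊,v}` by (H-CE) applied to `Π^temp_{𝔾,b} ≤ Π^temp_{𝔾,v}`
(`R.Hb_le`); if `b` abuts to no vertex the first factor is `⊤`. [cite: MochizukiSemiAnbd2006, §5, p. 65] -/
theorem arithBrGp_eq_commensurator_map_of_hCE (R : ChartRepresentatives c) (ι : c.G →* Gtp)
    (hCE : ∀ (e : 𝒢.graph.Edge) (v : 𝒢.graph.Vertex) (L H : Subgroup c.G),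
      L ∈ edgeLikeSubgroups c e → H ∈ verticialSubgroups c v → L ≤ H →
        Subgroup.Commensurable.commensurator (L.map ι) ≤
          Subgroup.Commensurable.commensurator (H.map ι))
    (b : 𝒢.graph.Branch) :
    arithBrGp R ι b = Subgroup.Commensurable.commensurator ((R.Hb b).map ι) := by
  cases hb : 𝒢.graph.abuts b with
  | none =>
    rw [arithBrGp, hb, Option.map_none, Option.getD_none]
    exact top_inf_eq _
  | some v =>
    rw [arithBrGp_of_abuts R ι hb]
    exact inf_eq_right.mpr (hCE _ _ _ _ (R.Hb_mem b) (R.Hv_mem v) (R.Hb_le b v hb))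

/-- In the currency of `DecompositionData`: the produced `brGp b` is `C(ι Π^temp_{𝔾,b})` under (H-CE).
[cite: MochizukiSemiAnbd2006, §5, p. 65] -/
theorem decompositionDataOfChart_brGp_eq_commensurator_map_of_hCE (R : ChartRepresentatives c)
    (ι : c.G →* Gtp)
    (hCE : ∀ (e : 𝒢.graph.Edge) (v : 𝒢.graph.Vertex) (L H : Subgroup c.G),
      L ∈ edgeLikeSubgroups c e → H ∈ verticialSubgroups c v → L ≤ H →
        Subgroup.Commensurable.commensurator (L.map ι) ≤
          Subgroup.Commensurable.commensurator (H.map ι))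
    (b : 𝒢.graph.Branch) :
    (decompositionDataOfChart R ι).brGp b = Subgroup.Commensurable.commensurator ((R.Hb b).map ι) :=
  arithBrGp_eq_commensurator_map_of_hCE R ι hCE b

/-! ### The edge-like notion of the produced data does not depend on the representatives -/

/-- Transport of a `Π^temp_𝔾`-conjugate through `ι`: `ι(h · L · h⁻¹) = ι(h) · ι(L) · ι(h)⁻¹`. [folklore] -/
private theorem map_map_conj_eq_conjSubgroup (ι : c.G →* Gtp) (L : Subgroup c.G) (h : c.G) :
    (L.map (MulAut.conj h).toMonoidHom).map ι = conjSubgroup (ι h) (L.map ι) := by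
  rw [conjSubgroup, Subgroup.map_map, Subgroup.map_map]
  congr 1
  ext x
  simp [MulAut.conj_apply]

/-- `g · (k · K · k⁻¹) · g⁻¹ = (g k) · K · (g k)⁻¹`. [folklore] -/
private theorem conjSubgroup_conjSubgroup_eq (g k : Gtp) (K : Subgroup Gtp) :
    conjSubgroup g (conjSubgroup k K) = conjSubgroup (g * k) K := by
  rw [conjSubgroup, conjSubgroup, conjSubgroup, Subgroup.map_map]
  congr 1
  ext x
  simp [MulAut.conj_apply, mul_assoc]

/-- **The edge-like subgroups (Def 5.3 (iii)) of the produced data, `R`-free, under (H-CE)**: they are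
exactly the conjugates of the commensurators of the images of the §3 edge-like subgroups — for ANY member of
`edgeLikeSubgroups c (edgeOf b)`, not only the chosen representative (one conjugacy class per edge,
`exists_conj_of_mem_edgeLikeSubgroups`, Thm 3.7 (iii); commensurators are conjugation-equivariant,
`commensurator_conjSubgroup`).  The right-hand side does not mention `R`.
[cite: MochizukiSemiAnbd2006, Def 5.3 (iii), p. 65] -/
theorem isEdgeLike_decompositionDataOfChart_iff_of_hCE (R : ChartRepresentatives c) (ι : c.G →* Gtp)
    (hCE : ∀ (e : 𝒢.graph.Edge) (v : 𝒢.graph.Vertex) (L H : Subgroup c.G),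
      L ∈ edgeLikeSubgroups c e → H ∈ verticialSubgroups c v → L ≤ H →
        Subgroup.Commensurable.commensurator (L.map ι) ≤
          Subgroup.Commensurable.commensurator (H.map ι))
    (K : Subgroup Gtp) :
    IsEdgeLike (decompositionDataOfChart R ι) K ↔
      ∃ (b : 𝒢.graph.Branch) (L : Subgroup c.G) (g : Gtp), L ∈ edgeLikeSubgroups c (𝒢.graph.edgeOf b) ∧
        K = conjSubgroup g (Subgroup.Commensurable.commensurator (L.map ι)) := by
  constructor
  · rintro ⟨b, g, rfl⟩
    refine ⟨b, R.Hb b, g, R.Hb_mem b, ?_⟩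
    rw [decompositionDataOfChart_brGp_eq_commensurator_map_of_hCE R ι hCE b]
  · rintro ⟨b, L, g, hL, rfl⟩
    -- `L = h · Hb b · h⁻¹` for some `h ∈ Π^temp_𝔾` (one conjugacy class per edge)
    obtain ⟨h, rfl⟩ := exists_conj_of_mem_edgeLikeSubgroups c (R.Hb_mem b) hL
    refine ⟨b, g * ι h, ?_⟩
    rw [decompositionDataOfChart_brGp_eq_commensurator_map_of_hCE R ι hCE b,
      map_map_conj_eq_conjSubgroup, commensurator_conjSubgroup, conjSubgroup_conjSubgroup_eq]

/-- **Rc-INVARIANCE of the edge-like notion** (row «T54·Rc-INVARIANCE», edge half): under (H-CE), for any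
two compatible choices `R`, `R'` of §3 representatives the produced decomposition data have the SAME edge-like
subgroups — "`Π^temp_{𝔊,b}` … well-defined up to conjugation in `Π^temp_𝔊`" (p. 65) for OUR commensurator model,
loop edges included (both branch representatives of one edge give conjugate commensurators).
[cite: MochizukiSemiAnbd2006, Def 5.3 (iii), p. 65] -/
theorem isEdgeLike_decompositionDataOfChart_iff_isEdgeLike_of_hCE (R R' : ChartRepresentatives c)
    (ι : c.G →* Gtp)
    (hCE : ∀ (e : 𝒢.graph.Edge) (v : 𝒢.graph.Vertex) (L H : Subgroup c.G),
      L ∈ edgeLikeSubgroups c e → H ∈ verticialSubgroups c v → L ≤ H →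
        Subgroup.Commensurable.commensurator (L.map ι) ≤
          Subgroup.Commensurable.commensurator (H.map ι))
    (K : Subgroup Gtp) :
    IsEdgeLike (decompositionDataOfChart R ι) K ↔ IsEdgeLike (decompositionDataOfChart R' ι) K := by
  rw [isEdgeLike_decompositionDataOfChart_iff_of_hCE R ι hCE K,
    isEdgeLike_decompositionDataOfChart_iff_of_hCE R' ι hCE K]

/-- The two notions of Def 5.3 (iii) for the produced data agree for any two choices of representatives
(vertex half: abc-iut-w4-d053's `isVerticial_decompositionDataOfChart_iff`, unconditional; edge half: under
(H-CE)) — the form consumed by a statement-level transfer. [cite: MochizukiSemiAnbd2006, Def 5.3 (iii), p. 65] -/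
theorem isVerticial_iff_and_isEdgeLike_iff_decompositionDataOfChart_of_hCE (R R' : ChartRepresentatives c)
    (ι : c.G →* Gtp)
    (hCE : ∀ (e : 𝒢.graph.Edge) (v : 𝒢.graph.Vertex) (L H : Subgroup c.G),
      L ∈ edgeLikeSubgroups c e → H ∈ verticialSubgroups c v → L ≤ H →
        Subgroup.Commensurable.commensurator (L.map ι) ≤
          Subgroup.Commensurable.commensurator (H.map ι)) :
    (∀ K : Subgroup Gtp,
        IsVerticial (decompositionDataOfChart R ι) K ↔ IsVerticial (decompositionDataOfChart R' ι) K) ∧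
      ∀ K : Subgroup Gtp,
        IsEdgeLike (decompositionDataOfChart R ι) K ↔ IsEdgeLike (decompositionDataOfChart R' ι) K := by
  refine ⟨fun K => ?_, fun K => isEdgeLike_decompositionDataOfChart_iff_isEdgeLike_of_hCE R R' ι hCE K⟩
  rw [isVerticial_decompositionDataOfChart_iff R ι K, isVerticial_decompositionDataOfChart_iff R' ι K]

/-! ### The same over the branch-granular chart action: (H-CE) bound by name -/

variable {PA : Type u''} [Group PA] [TopologicalSpace PA] {ι : c.G →* Gtp} {aug : Gtp →* PA}
  {actV : PA → 𝒢.graph.Vertex → 𝒢.graph.Vertex} {actE : PA → 𝒢.graph.Edge → 𝒢.graph.Edge}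
  {actB : PA → 𝒢.graph.Branch → 𝒢.graph.Branch}

/-- **`Π^temp_{𝔊,b} = C(ι Π^temp_{𝔾,b})` for EVERY branch, over `ArithChartBranchAction`** with no switching of
branches, `ι` injective, the print hypotheses and Thm 3.7 (iii) at `𝒢` — (H-CE) supplied by abc-iut-w4-d040's
`ArithChartBranchAction.commensurator_map_le_of_edgeLike_le_verticialAt`.
[cite: MochizukiSemiAnbd2006, §5 p. 65 / Thm 5.4 p. 66] -/
theorem ArithChartBranchAction.arithBrGp_eq_commensurator_mapAt
    (A : ArithChartBranchAction c ι aug actV actE actB) (h : CompactInVerticialAt 𝒢)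
    (h𝒢 : 𝒢.Thm37Hypotheses) (hG : 𝒢.graph.IsGraph) (hι : Function.Injective ι)
    (hns : NoBranchSwitching 𝒢.graph.edgeOf actB) (R : ChartRepresentatives c) (b : 𝒢.graph.Branch) :
    arithBrGp R ι b = Subgroup.Commensurable.commensurator ((R.Hb b).map ι) :=
  arithBrGp_eq_commensurator_map_of_hCE R ι
    (fun _ _ _ _ hL hH hLH => A.commensurator_map_le_of_edgeLike_le_verticialAt h h𝒢 hG hι hns hL hH hLH) b

/-- **The edge-like subgroups of the produced data, `R`-free, over `ArithChartBranchAction`** (no switching,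
`ι` injective, print hypotheses, Thm 3.7 (iii) at `𝒢`). [cite: MochizukiSemiAnbd2006, Def 5.3 (iii) p. 65 / Thm 5.4 p. 66] -/
theorem ArithChartBranchAction.isEdgeLike_decompositionDataOfChart_iffAt
    (A : ArithChartBranchAction c ι aug actV actE actB) (h : CompactInVerticialAt 𝒢)
    (h𝒢 : 𝒢.Thm37Hypotheses) (hG : 𝒢.graph.IsGraph) (hι : Function.Injective ι)
    (hns : NoBranchSwitching 𝒢.graph.edgeOf actB) (R : ChartRepresentatives c) (K : Subgroup Gtp) :
    IsEdgeLike (decompositionDataOfChart R ι) K ↔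
      ∃ (b : 𝒢.graph.Branch) (L : Subgroup c.G) (g : Gtp), L ∈ edgeLikeSubgroups c (𝒢.graph.edgeOf b) ∧
        K = conjSubgroup g (Subgroup.Commensurable.commensurator (L.map ι)) :=
  isEdgeLike_decompositionDataOfChart_iff_of_hCE R ι
    (fun _ _ _ _ hL hH hLH => A.commensurator_map_le_of_edgeLike_le_verticialAt h h𝒢 hG hι hns hL hH hLH) K

/-- **Rc-INVARIANCE of the edge-like notion over `ArithChartBranchAction`** (no switching, `ι` injective,
print hypotheses, Thm 3.7 (iii) at `𝒢` — a theorem for finite `𝔾`, `compactInVerticialAt_of_finiteGraph`): any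
two choices `R`, `R'` of representatives produce the same edge-like subgroups.
[cite: MochizukiSemiAnbd2006, Def 5.3 (iii) p. 65 / Thm 5.4 p. 66] -/
theorem ArithChartBranchAction.isEdgeLike_decompositionDataOfChart_iff_isEdgeLikeAt
    (A : ArithChartBranchAction c ι aug actV actE actB) (h : CompactInVerticialAt 𝒢)
    (h𝒢 : 𝒢.Thm37Hypotheses) (hG : 𝒢.graph.IsGraph) (hι : Function.Injective ι)
    (hns : NoBranchSwitching 𝒢.graph.edgeOf actB) (R R' : ChartRepresentatives c) (K : Subgroup Gtp) :
    IsEdgeLike (decompositionDataOfChart R ι) K ↔ IsEdgeLike (decompositionDataOfChart R' ι) K :=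
  isEdgeLike_decompositionDataOfChart_iff_isEdgeLike_of_hCE R R' ι
    (fun _ _ _ _ hL hH hLH => A.commensurator_map_le_of_edgeLike_le_verticialAt h h𝒢 hG hι hns hL hH hLH) K

/-- Both notions of Def 5.3 (iii) agree for any two choices of representatives, over
`ArithChartBranchAction` (the form consumed by a statement-level transfer).
[cite: MochizukiSemiAnbd2006, Def 5.3 (iii) p. 65 / Thm 5.4 p. 66] -/
theorem ArithChartBranchAction.isVerticial_iff_and_isEdgeLike_iff_decompositionDataOfChartAt
    (A : ArithChartBranchAction c ι aug actV actE actB) (h : CompactInVerticialAt 𝒢)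
    (h𝒢 : 𝒢.Thm37Hypotheses) (hG : 𝒢.graph.IsGraph) (hι : Function.Injective ι)
    (hns : NoBranchSwitching 𝒢.graph.edgeOf actB) (R R' : ChartRepresentatives c) :
    (∀ K : Subgroup Gtp,
        IsVerticial (decompositionDataOfChart R ι) K ↔ IsVerticial (decompositionDataOfChart R' ι) K) ∧
      ∀ K : Subgroup Gtp,
        IsEdgeLike (decompositionDataOfChart R ι) K ↔ IsEdgeLike (decompositionDataOfChart R' ι) K :=
  isVerticial_iff_and_isEdgeLike_iff_decompositionDataOfChart_of_hCE R R' ι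
    (fun _ _ _ _ hL hH hLH => A.commensurator_map_le_of_edgeLike_le_verticialAt h h𝒢 hG hι hns hL hH hLH)

end ProfiniteSemiGraph

end Literature.AnabelianGeometry.SemiGraphs
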